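import Mathlib
import HarnessLib
import Summits.Ventures.LatticeQCDFlow.Exactness.IMHErgodic
import Summits.Ventures.LatticeQCDFlow.Exactness.NCMCGeneralSpaceMarkovHarmonic

/-!
# The exact flow sampler converges from EVERY initial configuration; the path-IMH lane from every initial record

HONEST FRAMING: exact (Metropolis-corrected) sampling algorithms for lattice gauge theory;
figures of merit are autocorrelation/cost numbers at stated couplings and volumes; no
continuum-physics claim.

Venture `LatticeQCDFlow` (cell pub-lqcd), topic `Exactness`; FANOUT row 13 (`eng-snf`, GEN-17).
NEW WORK of the cell, not a published result; no definition is introduced; nothing is cited as a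
fact (Birkhoff enters as the tree-PROVED `Literature.Dynamics.Ergodic.birkhoff_ergodic_theorem…`).
`IMHErgodic.lean` proved: independence Metropolis `indepMH q w` with a positive weight, started in an
invariant law `π`, is ergodic, so time averages converge for `π`-ALMOST EVERY start.  A flow sampler
is started from ONE configuration (a cold start, a previous run's last field).  This file removes
the exceptional null set: the hitting probability `h(z) = P_{δ_z}(averages of φ converge to ∫ φ dπ)`
is harmonic (`NCMCGeneralSpaceMarkovHarmonic`), equals `1` `π`-a.e., hence `q`-a.e. when `q ≪ π`,
and one step of the kernel gives `h(z) = A(z) + (1 − A(z)) h(z)` with acceptance mass `A(z) > 0` —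
so `h(z) = 1` for EVERY `z`.

## Content

* §1 `lintegral_indepMH` (`∫ g dK(z, ·) = ∫ a(z, y) g(y) q(dy) + (1 − A(z)) g(z)`),
  `imhAcceptMass_ne_zero`; **`trajMeasure_dirac_eq_one_indepMH`** — for `w > 0` measurable, an
  invariant probability law `π` with `q ≪ π`, and a measurable shift-invariant event `A` with
  `P_π(A) = 1`: `P_{δ_z}(A) = 1` for EVERY `z`; **`tendsto_sum_div_ae_indepMH_everyStart`** — for
  every measurable `φ ∈ L¹(π)` and EVERY start `z`, `P_{δ_z}`-a.s. `(1/n) Σ_{i<n} φ(x_i) → ∫ φ dπ`.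
* §2 `withDensity_ofReal_absolutelyContinuous`; **`tendsto_sum_div_ae_flowMCMC_everyStart`** — THE
  EXACT FLOW SAMPLER (`FlowSamplerExact.lean`: positive measurable densities `p`, `q̃` against `vol`,
  `p · vol` and `q̃ · vol` probability laws): from EVERY initial configuration `x₀`, almost surely
  `(1/n) Σ_{i<n} φ(x_i) → ∫ φ d(p · vol)` for every measurable `φ ∈ L¹(p · vol)` — whatever the flow.
* §3 **`CrooksPair.tendsto_endpointMean_pathIMH_everyStart`** (with GEN-12's
  `CrooksPair.fwdPathLaw_absolutelyContinuous`, `P_F ≪ P_R`) — THE PATH-IMH LANE: for every Crooks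
  pair between finite non-zero weights and EVERY initial record `ω₀`, the end-point readings of a
  measurable `g ∈ L¹(ν₁)` average to `Z₁⁻¹ ∫ g dν₁` almost surely.

NOT CLAIMED: rates; anything for kernels other than independence Metropolis (the NCMC switch and
tempered-transition lanes keep their "almost every start" statements — their kernels have no
state-independent proposal to regenerate from).
-/

namespace Summit.Ventures.LatticeQCDFlow.Exactness

open MeasureTheory ProbabilityTheory Set Filter Finset
open scoped ENNReal Topology

variable {S : Type*} [MeasurableSpace S]

/-! ## §1 Independence Metropolis: a harmonic function equal to one `q`-a.e. is one everywhere -/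

section IMH

variable {q : Measure S} [IsProbabilityMeasure q] {w : S → ℝ}

/-- Integration against one step of the independence-Metropolis kernel:
`∫ g dK(z, ·) = ∫ a(z, y) g(y) q(dy) + (1 − A(z)) g(z)`. -/
theorem lintegral_indepMH (hw : Measurable w) (z : S) {g : S → ℝ≥0∞} (hg : Measurable g) :
    ∫⁻ y, g y ∂(indepMH q w z) =
      ∫⁻ y, imhAcceptE w z y * g y ∂q + (1 - imhAcceptMass q w z) * g z := by
  have h2 : Measurable (Function.uncurry fun (x : S) (_ : S) => 1 - imhAcceptMass q w x) :=
    measurable_const.sub ((measurable_imhAcceptMass q hw).comp measurable_fst)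
  rw [indepMH, Kernel.add_apply, lintegral_add_measure,
    Kernel.withDensity_apply _ (measurable_imhAcceptE hw), Kernel.const_apply,
    lintegral_withDensity_eq_lintegral_mul _ (measurable_imhAcceptE hw).of_uncurry_left hg,
    Kernel.withDensity_apply _ h2, Kernel.deterministic_apply, id, withDensity_const,
    lintegral_smul_measure, lintegral_dirac' _ hg, smul_eq_mul]
  rfl

/-- The acceptance mass `A(z) = ∫ a(z, y) q(dy)` is never zero for a positive weight. -/
theorem imhAcceptMass_ne_zero (hw : Measurable w) (hw0 : ∀ x, 0 < w x) (z : S) :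
    imhAcceptMass q w z ≠ 0 := by
  intro h0
  rw [imhAcceptMass, lintegral_eq_zero_iff (measurable_imhAcceptE hw).of_uncurry_left] at h0
  have hfalse : ∀ᵐ y ∂q, False := h0.mono fun y hy => (imhAcceptE_pos hw0 z y).ne' hy
  rw [eventually_false_iff_eq_bot, ae_eq_bot] at hfalse
  exact IsProbabilityMeasure.ne_zero q hfalse

/-- **A shift-invariant event that is almost sure from the target is sure from EVERY start.**
`w > 0` measurable, `π` a probability law with `q ≪ π`, `A` measurable with `θ⁻¹A = A` and
`P_π(A) = 1`: then `P_{δ_z}(A) = 1` for every `z` (harmonicity + one kernel step: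
`h(z) = A(z) + (1 − A(z)) h(z)`, `A(z) > 0`). -/
theorem trajMeasure_dirac_eq_one_indepMH (hw : Measurable w) (hw0 : ∀ x, 0 < w x) {π : Measure S}
    [IsProbabilityMeasure π] (hqπ : q ≪ π)
    {A : Set (ℕ → S)} (hA : MeasurableSet A)
    (hinv : (fun (x : ℕ → S) (k : ℕ) => x (k + 1)) ⁻¹' A = A)
    (hπA : haveI : Fact (Measurable w) := ⟨hw⟩
      Kernel.trajMeasure (X := fun _ : ℕ => S) π
        (fun n : ℕ => (indepMH q w).comap (fun h : (j : ↥(Finset.Iic n)) → S =>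
          h ⟨n, Finset.mem_Iic.2 le_rfl⟩) (measurable_pi_apply _)) A = 1) (z : S) :
    haveI : Fact (Measurable w) := ⟨hw⟩
    Kernel.trajMeasure (X := fun _ : ℕ => S) (Measure.dirac z)
      (fun n : ℕ => (indepMH q w).comap (fun h : (j : ↥(Finset.Iic n)) → S =>
        h ⟨n, Finset.mem_Iic.2 le_rfl⟩) (measurable_pi_apply _)) A = 1 := by
  haveI : Fact (Measurable w) := ⟨hw⟩
  set h : S → ℝ≥0∞ := fun y => Kernel.trajMeasure (X := fun _ : ℕ => S) (Measure.dirac y)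
    (fun n : ℕ => (indepMH q w).comap (fun h : (j : ↥(Finset.Iic n)) → S =>
      h ⟨n, Finset.mem_Iic.2 le_rfl⟩) (measurable_pi_apply _)) A with hh
  have hm : Measurable h := GeneralNCMC.measurable_trajMeasure_dirac _ hA
  have hle : ∀ y, h y ≤ 1 := fun y => prob_le_one
  -- `h = 1` `π`-a.e., hence `q`-a.e.
  have hae : ∀ᵐ y ∂q, h y = 1 :=
    hqπ.ae_le (GeneralNCMC.trajMeasure_dirac_ae_eq_one_of_eq_one _ hA hπA)
  -- harmonicity at `z`, one kernel step
  have hharm := GeneralNCMC.trajMeasure_dirac_eq_lintegral_of_shift_invariant (indepMH q w) hA hinv z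
  change h z = ∫⁻ y, h y ∂(indepMH q w z) at hharm
  rw [lintegral_indepMH hw z hm] at hharm
  have hint : ∫⁻ y, imhAcceptE w z y * h y ∂q = imhAcceptMass q w z := by
    rw [imhAcceptMass]
    exact lintegral_congr_ae (hae.mono fun y hy => by
      change imhAcceptE w z y * h y = imhAcceptE w z y
      rw [hy, mul_one])
  rw [hint] at hharm
  -- solve `h z = a + (1 − a) h z` with `0 < a ≤ 1`, `h z ≤ 1`
  have ha0 : imhAcceptMass q w z ≠ 0 := imhAcceptMass_ne_zero hw hw0 z
  have ha1 : imhAcceptMass q w z ≤ 1 := imhAcceptMass_le_one q w z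
  have ha_top : imhAcceptMass q w z ≠ ∞ := ne_top_of_le_ne_top ENNReal.one_ne_top ha1
  have hh_top : h z ≠ ∞ := ne_top_of_le_ne_top ENNReal.one_ne_top (hle z)
  have key : (h z).toReal = (imhAcceptMass q w z).toReal +
      (1 - (imhAcceptMass q w z).toReal) * (h z).toReal := by
    have e := congrArg ENNReal.toReal hharm
    rw [ENNReal.toReal_add ha_top (ENNReal.mul_ne_top (ne_top_of_le_ne_top ENNReal.one_ne_top
      tsub_le_self) hh_top), ENNReal.toReal_mul, ENNReal.toReal_sub_of_le ha1 ENNReal.one_ne_top,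
      ENNReal.toReal_one] at e
    exact e
  have ha_pos : 0 < (imhAcceptMass q w z).toReal := ENNReal.toReal_pos ha0 ha_top
  have h2 : (imhAcceptMass q w z).toReal * (h z).toReal = (imhAcceptMass q w z).toReal * 1 := by
    linear_combination key
  exact (ENNReal.toReal_eq_one_iff (h z)).1 (mul_left_cancel₀ ha_pos.ne' h2)

/-- **TIME AVERAGES CONVERGE FROM EVERY START.**  `w > 0` measurable, `π` an invariant probability
law with `q ≪ π`: for every measurable `φ ∈ L¹(π)` and EVERY initial point `z`, along the
independence-Metropolis chain started at `z`, `(1/n) Σ_{i<n} φ(x_i) → ∫ φ dπ` almost surely. -/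
theorem tendsto_sum_div_ae_indepMH_everyStart (hw : Measurable w) (hw0 : ∀ x, 0 < w x)
    {π : Measure S} [IsProbabilityMeasure π] (hπ : Kernel.Invariant (indepMH q w) π) (hqπ : q ≪ π)
    {φ : S → ℝ} (hφm : Measurable φ) (hφ : Integrable φ π) (z : S) :
    haveI : Fact (Measurable w) := ⟨hw⟩
    ∀ᵐ x ∂(Kernel.trajMeasure (X := fun _ : ℕ => S) (Measure.dirac z)
        (fun n : ℕ => (indepMH q w).comap (fun h : (j : ↥(Finset.Iic n)) → S =>
          h ⟨n, Finset.mem_Iic.2 le_rfl⟩) (measurable_pi_apply _))),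
      Tendsto (fun n : ℕ => (∑ i ∈ range n, φ (x i)) / n) atTop (𝓝 (∫ a, φ a ∂π)) := by
  haveI : Fact (Measurable w) := ⟨hw⟩
  have hA := GeneralNCMC.measurableSet_cesaroSet (S := S) hφm (∫ a, φ a ∂π)
  have hinv := GeneralNCMC.preimage_shift_cesaroSet (S := S) φ (∫ a, φ a ∂π)
  have hπA : Kernel.trajMeasure (X := fun _ : ℕ => S) π
      (fun n : ℕ => (indepMH q w).comap (fun h : (j : ↥(Finset.Iic n)) → S =>
        h ⟨n, Finset.mem_Iic.2 le_rfl⟩) (measurable_pi_apply _))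
      {x : ℕ → S | Tendsto (fun n : ℕ => (∑ i ∈ range n, φ (x i)) / n) atTop (𝓝 (∫ a, φ a ∂π))}
      = 1 := by
    have h := tendsto_sum_div_ae_indepMH hw hw0 hπ hφ
    rw [ae_iff, ← Set.compl_setOf] at h
    exact (prob_compl_eq_zero_iff hA).1 h
  have h1 := trajMeasure_dirac_eq_one_indepMH hw hw0 hqπ hA hinv hπA z
  rw [ae_iff, ← Set.compl_setOf]
  exact (prob_compl_eq_zero_iff hA).2 h1

end IMH

/-! ## §2 The exact flow sampler from every initial configuration -/

section Flow

variable {vol : Measure S} {p q : S → ℝ}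

/-- Two positive densities against the same reference volume give mutually absolutely continuous
laws: `q̃ · vol ≪ p · vol` for `p > 0`. -/
theorem withDensity_ofReal_absolutelyContinuous (hp : Measurable p) (hp0 : ∀ x, 0 < p x)
    (q : S → ℝ) :
    (vol.withDensity fun x => ENNReal.ofReal (q x)) ≪ vol.withDensity fun x => ENNReal.ofReal (p x) := by
  refine Measure.AbsolutelyContinuous.mk fun B _ hB0 => ?_
  rw [withDensity_apply_eq_zero' hp.ennreal_ofReal.aemeasurable] at hB0
  have hsupp : {x | ENNReal.ofReal (p x) ≠ 0} = univ := by
    ext x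
    simp only [mem_setOf_eq, mem_univ, iff_true, ne_eq, ENNReal.ofReal_eq_zero, not_le]
    exact hp0 x
  rw [hsupp, univ_inter] at hB0
  exact withDensity_absolutelyContinuous _ _ hB0

/-- **THE EXACT FLOW SAMPLER CONVERGES FROM EVERY INITIAL CONFIGURATION.**  Reference volume
`vol`, target density `p > 0`, model density `q̃ > 0` (measurable; `p · vol`, `q̃ · vol` probability
laws): for every measurable `φ ∈ L¹(p · vol)` and EVERY starting point `x₀`, along the flow-MCMC
chain `indepMH (q̃ · vol) (p/q̃)` started at `x₀`, `(1/n) Σ_{i<n} φ(x_i) → ∫ φ d(p · vol)` almost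
surely — whatever the flow, with no bound on the importance weights. -/
theorem tendsto_sum_div_ae_flowMCMC_everyStart (hp : Measurable p) (hq : Measurable q)
    (hp0 : ∀ x, 0 < p x) (hq0 : ∀ x, 0 < q x)
    [IsProbabilityMeasure (vol.withDensity fun x => ENNReal.ofReal (q x))]
    [IsProbabilityMeasure (vol.withDensity fun x => ENNReal.ofReal (p x))] {φ : S → ℝ}
    (hφm : Measurable φ) (hφ : Integrable φ (vol.withDensity fun x => ENNReal.ofReal (p x)))
    (x₀ : S) :
    haveI : Fact (Measurable fun x => p x / q x) := ⟨hp.div hq⟩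
    ∀ᵐ x ∂(Kernel.trajMeasure (X := fun _ : ℕ => S) (Measure.dirac x₀)
        (fun n : ℕ => (indepMH (vol.withDensity fun x => ENNReal.ofReal (q x))
          (fun x => p x / q x)).comap (fun h : (j : ↥(Finset.Iic n)) → S =>
            h ⟨n, Finset.mem_Iic.2 le_rfl⟩) (measurable_pi_apply _))),
      Tendsto (fun n : ℕ => (∑ i ∈ range n, φ (x i)) / n) atTop
        (𝓝 (∫ a, φ a ∂(vol.withDensity fun x => ENNReal.ofReal (p x)))) :=
  tendsto_sum_div_ae_indepMH_everyStart (hp.div hq) (fun x => div_pos (hp0 x) (hq0 x))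
    (flowMCMC_invariant hp hq hp0 hq0) (withDensity_ofReal_absolutelyContinuous hp hp0 q) hφm hφ x₀

end Flow

/-! ## §3 The path-IMH lane from every initial record -/

namespace GeneralNCMC.CrooksPair

variable {E : Type*} [MeasurableSpace E]
variable {ν₀ ν₁ : Measure S} [IsFiniteMeasure ν₀] [IsFiniteMeasure ν₁] {κF κR : Kernel S E}
  [IsMarkovKernel κF] [IsMarkovKernel κR] {s e : E → S} {W : E → ℝ}

/-- **THE PATH-IMH LANE CONVERGES FROM EVERY INITIAL RECORD.**  For every Crooks pair between
finite non-zero level weights, every measurable `g ∈ L¹(ν₁)` and EVERY initial record `ω₀`: along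
the path-IMH chain (proposal `P_F`, weight `e^{−W}`) started at `ω₀`, the end-point readings
`(1/n) Σ_{i<n} g(e(ω_i))` converge to `Z₁⁻¹ ∫ g dν₁` almost surely. -/
theorem tendsto_endpointMean_pathIMH_everyStart (h0 : ν₀ univ ≠ 0) (h1 : ν₁ univ ≠ 0)
    (h : CrooksPair ν₀ ν₁ κF κR s e W) {g : S → ℝ} (hgm : Measurable g) (hg : Integrable g ν₁)
    (ω₀ : E) :
    haveI := isProbabilityMeasure_fwdPathLaw ν₀ h0 κF
    haveI : Fact (Measurable fun ε => Real.exp (-W ε)) :=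
      ⟨Real.measurable_exp.comp h.measurable_W.neg⟩
    ∀ᵐ x ∂(Kernel.trajMeasure (X := fun _ : ℕ => E) (Measure.dirac ω₀)
        (fun n : ℕ => (indepMH (fwdPathLaw ν₀ κF) fun ε => Real.exp (-W ε)).comap
          (fun hh : (j : ↥(Finset.Iic n)) → E => hh ⟨n, Finset.mem_Iic.2 le_rfl⟩)
          (measurable_pi_apply _))),
      Tendsto (fun n : ℕ => (∑ i ∈ range n, g (e (x i))) / n) atTop
        (𝓝 (((ν₁ univ).toReal)⁻¹ * ∫ y, g y ∂ν₁)) := by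
  haveI := isProbabilityMeasure_fwdPathLaw ν₀ h0 κF
  haveI := isProbabilityMeasure_fwdPathLaw ν₁ h1 κR
  have hmap := h.map_end_fwdPathLaw_rev
  have hge : Integrable g ((fwdPathLaw ν₁ κR).map e) := by
    rw [hmap]
    exact hg.smul_measure (ENNReal.inv_ne_top.2 h1)
  have hint : Integrable (fun ε => g (e ε)) (fwdPathLaw ν₁ κR) := hge.comp_measurable h.measurable_e
  have hval : ∫ ε, g (e ε) ∂(fwdPathLaw ν₁ κR) = ((ν₁ univ).toReal)⁻¹ * ∫ y, g y ∂ν₁ := by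
    rw [← integral_map h.measurable_e.aemeasurable hgm.aestronglyMeasurable, hmap,
      integral_smul_measure, ENNReal.toReal_inv, smul_eq_mul]
  have key := tendsto_sum_div_ae_indepMH_everyStart (w := fun ε => Real.exp (-W ε))
    (Real.measurable_exp.comp h.measurable_W.neg) (fun ε => Real.exp_pos _)
    (h.invariant_pathIMH_fwdPathLaw h0) (fwdPathLaw_absolutelyContinuous h0 h1 h)
    (φ := fun ε => g (e ε)) (hgm.comp h.measurable_e) hint ω₀
  rw [hval] at key
  exact key

end GeneralNCMC.CrooksPair

end Summit.Ventures.LatticeQCDFlow.Exactness
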